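import Literature.Topology.FourManifolds.InverseFunctionTheorem
import Literature.Topology.FourManifolds.DiffeotopyPartialTransport
import HarnessLib

/-!
# Injective immersions of open subsets of the model space are charts; transport of compactly
# supported diffeomorphisms along them

Topic `Literature/Topology/FourManifolds`.  Manifold-side plumbing for the uniqueness of
`1`-handles along a common core (`OneHandleUniqueness.lean`, Hirsch, *Differential Topology*
(1976), Ch. 4 §5, Thm. 5.3 with Ch. 8 §1, Thm. 1.3), where the handles are *read on the model*:
maps `h : E → X` of the whole model vector space into the manifold which are smooth, injective and
immersive only on an open set `W ⊆ E`.  Everything here is **proved**; no definition and no named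
fact is introduced.

* `exists_openPartialHomeomorph_of_injOn_of_mfderiv_injective` — **an injective immersion of an
  open subset of the model space into an equidimensional manifold is a diffeomorphism onto an open
  subset**: for `W ⊆ E` open and `h : E → X` (`X` a Hausdorff `C^∞` manifold modelled on the
  finite-dimensional space `E`) which is `C^∞` and injective on `W` with injective differential at
  every point of `W`, there is an open partial homeomorphism `e : E ⇀ X` with `⇑e = h`,
  `e.source = W` (so `e.target = h '' W` is open) whose inverse is `C^∞` on `e.target`.  Proof: at
  each point of `W` the differential is a linear isomorphism (finite dimension), so `h` is a local
  diffeomorphism there by the inverse function theorem on manifolds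
  (`isLocalDiffeomorphAt_of_mfderiv`, `InverseFunctionTheorem.lean`, Lee, *Introduction to Smooth
  Manifolds* (2013), Thm. 4.5); hence `h` is open on `W`, and the global inverse agrees near each
  point of the image with the local inverse, which is smooth (Hirsch (1976), Ch. 1 §3; Lee (2013),
  Prop. 5.2 / Thm. 4.14: an injective immersion which is open is a smooth embedding with smooth
  inverse).
* `exists_diffeomorph_transport_of_injOn` — **transport of a compactly supported diffeomorphism
  along such an immersion**: if moreover `s` is a diffeomorphism of `E` equal to the identity off a
  compact set `K ⊆ W`, then `h ∘ s ∘ h⁻¹` on `h(W)`, extended by the identity, is a diffeomorphism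
  `H` of `X` with `H (h y) = h (s y)` for `y ∈ W` and `H = id` off `h(K)` — the static form of the
  extension by the identity of a compactly supported diffeotopy of an open subset (Hirsch (1976),
  Ch. 8 §1, Thms. 1.3–1.4 and proof of Thm. 3.2; the tree's `exists_diffeomorph_chartTransport`,
  `ChartTransport.lean`, is the case of a chart with full target `E` and support in a ball).

## References

* M. W. Hirsch, *Differential Topology*, GTM 33, Springer (1976), Ch. 1 §3; Ch. 8 §1,
  Thms. 1.3–1.4, §3 proof of Thm. 3.2. [Hirsch1976]
* J. M. Lee, *Introduction to Smooth Manifolds*, 2nd ed., GTM 218 (2013), Thm. 4.5, Thm. 4.14,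
  Prop. 5.2. [LeeSmoothManifolds2013]
-/

noncomputable section

open Set Function Filter Topology
open scoped Manifold ContDiff

namespace Literature.Topology.FourManifolds

variable {E : Type*} [NormedAddCommGroup E] [NormedSpace ℝ E] [FiniteDimensional ℝ E]
  {X : Type*} [TopologicalSpace X] [ChartedSpace E X] [IsManifold 𝓘(ℝ, E) ∞ X]

/-! ### Injective immersions of open subsets of the model are charts -/

section Chart

/-- **At a point where its differential is injective, a map of an open subset of the model space
into an equidimensional manifold is a local diffeomorphism** (inverse function theorem on
manifolds: in finite dimension an injective linear endomorphism is an isomorphism).  The case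
`I = J = 𝓘(ℝ, E)` of the tree's `isLocalDiffeomorphAt_of_mfderiv_injective`
(`WhitneyModelSheets.lean`), restated to keep the imports of this file light.
[cite: LeeSmoothManifolds2013, Thm. 4.5] -/
theorem isLocalDiffeomorphAt_model_of_mfderiv_injective {h : E → X} {W : Set E} (hW : IsOpen W)
    (hs : ContMDiffOn 𝓘(ℝ, E) 𝓘(ℝ, E) ∞ h W) {p : E} (hp : p ∈ W)
    (hD : Injective (mfderiv 𝓘(ℝ, E) 𝓘(ℝ, E) h p)) :
    IsLocalDiffeomorphAt 𝓘(ℝ, E) 𝓘(ℝ, E) ∞ h p := by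
  haveI : CompleteSpace E := FiniteDimensional.complete ℝ E
  set L₀ : E →L[ℝ] E := mfderiv 𝓘(ℝ, E) 𝓘(ℝ, E) h p with hL₀
  have hinj' : Injective L₀ := hD
  have hsurj : Surjective L₀ :=
    (LinearMap.injective_iff_surjective (f := (L₀ : E →ₗ[ℝ] E))).1 hinj'
  set L : E ≃L[ℝ] E :=
    (LinearEquiv.ofBijective (L₀ : E →ₗ[ℝ] E) ⟨hinj', hsurj⟩).toContinuousLinearEquiv with hL
  refine isLocalDiffeomorphAt_of_mfderiv hW hp hs (by exact_mod_cast le_top) L ?_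
  ext v
  rfl

/-- **An injective immersion of an open subset of the model space into an equidimensional
Hausdorff manifold is a diffeomorphism onto an open subset**, packaged as an open partial
homeomorphism `e : E ⇀ X` with `⇑e = h`, `e.source = W` and inverse `C^∞` on `e.target = h '' W`
(Lee (2013), Prop. 5.2 with Thm. 4.14; Hirsch (1976), Ch. 1 §3). [cite: LeeSmoothManifolds2013, Prop. 5.2] -/
theorem exists_openPartialHomeomorph_of_injOn_of_mfderiv_injective {h : E → X} {W : Set E}
    (hW : IsOpen W) (hs : ContMDiffOn 𝓘(ℝ, E) 𝓘(ℝ, E) ∞ h W) (hinj : InjOn h W)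
    (hD : ∀ p ∈ W, Injective (mfderiv 𝓘(ℝ, E) 𝓘(ℝ, E) h p)) :
    ∃ e : OpenPartialHomeomorph E X, ⇑e = h ∧ e.source = W ∧ e.target = h '' W ∧
      ContMDiffOn 𝓘(ℝ, E) 𝓘(ℝ, E) ∞ e.symm e.target := by
  have hloc : ∀ p ∈ W, IsLocalDiffeomorphAt 𝓘(ℝ, E) 𝓘(ℝ, E) ∞ h p := fun p hp =>
    isLocalDiffeomorphAt_model_of_mfderiv_injective hW hs hp (hD p hp)
  -- images of open subsets of `W` are open
  have hopen : ∀ O : Set E, IsOpen O → O ⊆ W → IsOpen (h '' O) := by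
    intro O hO hOW
    rw [isOpen_iff_mem_nhds]
    rintro _ ⟨p, hp, rfl⟩
    obtain ⟨Φ, hpΦ, heq⟩ := hloc p (hOW hp)
    -- `h '' (O ∩ Φ.source) = Φ '' (O ∩ Φ.source)` is an open neighbourhood of `h p`
    have h1 : IsOpen (Φ.toOpenPartialHomeomorph '' (O ∩ Φ.source)) :=
      Φ.toOpenPartialHomeomorph.isOpen_image_of_subset_source (hO.inter Φ.open_source)
        inter_subset_right
    have h2 : Φ.toOpenPartialHomeomorph '' (O ∩ Φ.source) ⊆ h '' O := by
      rintro _ ⟨q, hq, rfl⟩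
      exact ⟨q, hq.1, heq hq.2⟩
    have h3 : h p ∈ Φ.toOpenPartialHomeomorph '' (O ∩ Φ.source) :=
      ⟨p, ⟨hp, hpΦ⟩, (heq hpΦ).symm⟩
    exact mem_of_superset (h1.mem_nhds h3) h2
  -- the open partial homeomorphism
  set pe : PartialEquiv E X := hinj.toPartialEquiv h W with hpe
  have hc : ContinuousOn pe pe.source := hs.continuousOn
  have ho : IsOpenMap (pe.source.restrict pe) := by
    intro O hO
    obtain ⟨t, ht, rfl⟩ := isOpen_induced_iff.1 hO
    have himg : pe.source.restrict pe '' (Subtype.val ⁻¹' t) = h '' (W ∩ t) := by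
      ext y
      constructor
      · rintro ⟨⟨x, hxW⟩, hxt, rfl⟩
        exact ⟨x, ⟨hxW, hxt⟩, rfl⟩
      · rintro ⟨x, ⟨hxW, hxt⟩, rfl⟩
        exact ⟨⟨x, hxW⟩, hxt, rfl⟩
    rw [himg]
    exact hopen _ (hW.inter ht) inter_subset_left
  set e : OpenPartialHomeomorph E X := OpenPartialHomeomorph.ofContinuousOpenRestrict pe hc ho hW
    with he_def
  have he_coe : ⇑e = h := rfl
  have he_source : e.source = W := rfl
  have he_target : e.target = h '' W := rfl
  refine ⟨e, he_coe, he_source, he_target, ?_⟩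
  -- smoothness of the inverse: near `h p` it is the local inverse of the local diffeomorphism
  intro y hy
  have hpy : e.symm y ∈ W := e.map_target hy
  set p := e.symm y with hp_def
  have hyp : h p = y := by rw [← he_coe]; exact e.right_inv hy
  have hl := hloc p hpy
  -- the local inverse agrees with `e.symm` near `y`
  have hev : e.symm =ᶠ[𝓝 y] hl.localInverse := by
    -- points of `localInverse.source` near `y` whose local inverse lies in `W`
    have hcont : ContinuousAt hl.localInverse (h p) := hl.localInverse_contMDiffAt.continuousAt
    have hmemW : ∀ᶠ z in 𝓝 (h p), hl.localInverse z ∈ W := by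
      have hpt : hl.localInverse (h p) ∈ W := by
        rw [hl.localInverse_left_inv hl.localInverse_mem_target]; exact hpy
      exact hcont.preimage_mem_nhds (hW.mem_nhds hpt)
    have hsrc : ∀ᶠ z in 𝓝 (h p), z ∈ hl.localInverse.source :=
      hl.localInverse_open_source.mem_nhds hl.localInverse_mem_source
    have htgt : ∀ᶠ z in 𝓝 y, z ∈ e.target := e.open_target.mem_nhds hy
    rw [hyp] at hmemW hsrc
    filter_upwards [hmemW, hsrc, htgt] with z hzW hzs hzt
    -- both are preimages of `z` under `h` in `W`
    have h1 : h (e.symm z) = z := by rw [← he_coe]; exact e.right_inv hzt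
    have h2 : h (hl.localInverse z) = z := hl.localInverse_right_inv hzs
    exact hinj (e.map_target hzt) hzW (h1.trans h2.symm)
  have hsm : ContMDiffAt 𝓘(ℝ, E) 𝓘(ℝ, E) ∞ hl.localInverse y := by
    rw [← hyp]; exact hl.localInverse_contMDiffAt
  exact (hsm.congr_of_eventuallyEq hev).contMDiffWithinAt

end Chart

/-! ### Transport of compactly supported diffeomorphisms along an injective immersion -/

section Transport

variable [T2Space X]

/-- **Transport of a compactly supported diffeomorphism along an injective immersion of an open
subset of the model space** (Hirsch (1976), Ch. 8 §1, Thms. 1.3–1.4; static form of the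
extension by the identity of a compactly supported diffeotopy of an open subset).  Let `h : E → X`
be `C^∞`, injective and immersive on the open set `W ⊆ E` (`X` an equidimensional Hausdorff
manifold), and `s` a diffeomorphism of `E` equal to the identity off a compact `K ⊆ W`.  Then
there is a diffeomorphism `H` of `X` with `H (h y) = h (s y)` for all `y ∈ W` and `H x = x` for
`x ∉ h '' K`. [cite: Hirsch1976, Ch. 8 §1, Thm. 1.3] -/
theorem exists_diffeomorph_transport_of_injOn {h : E → X} {W : Set E} (hW : IsOpen W)
    (hs : ContMDiffOn 𝓘(ℝ, E) 𝓘(ℝ, E) ∞ h W) (hinj : InjOn h W)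
    (hD : ∀ p ∈ W, Injective (mfderiv 𝓘(ℝ, E) 𝓘(ℝ, E) h p))
    (s : E ≃ₘ⟮𝓘(ℝ, E), 𝓘(ℝ, E)⟯ E) {K : Set E} (hK : IsCompact K) (hKW : K ⊆ W)
    (hsK : ∀ y, y ∉ K → s y = y) :
    ∃ H : X ≃ₘ⟮𝓘(ℝ, E), 𝓘(ℝ, E)⟯ X, (∀ y ∈ W, H (h y) = h (s y)) ∧
      ∀ x, x ∉ h '' K → H x = x := by
  classical
  obtain ⟨e, he, hsrc, htgt, hsymm⟩ :=
    exists_openPartialHomeomorph_of_injOn_of_mfderiv_injective hW hs hinj hD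
  -- `s` and `s⁻¹` are the identity off `K` and preserve `W`
  have hsK' : ∀ y, y ∉ K → s.symm y = y := fun y hy => by
    conv_lhs => rw [← hsK y hy]
    exact s.symm_apply_apply y
  have hsW : ∀ y ∈ W, s y ∈ W := fun y hy => by
    by_cases hyK : y ∈ K
    · exact hKW (Diffeotopy.mapsTo_of_eq_self_off s.injective hsK hyK)
    · rw [hsK y hyK]; exact hy
  have hsW' : ∀ y ∈ W, s.symm y ∈ W := fun y hy => by
    by_cases hyK : y ∈ K
    · exact hKW (Diffeotopy.mapsTo_of_eq_self_off s.symm.injective hsK' hyK)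
    · rw [hsK' y hyK]; exact hy
  -- the transported maps
  set F : (E → E) → X → X := fun σ x => if x ∈ e.target then h (σ (e.symm x)) else x with hF
  have hF_mem : ∀ (σ : E → E) {x : X}, x ∈ e.target → F σ x = h (σ (e.symm x)) :=
    fun σ x hx => by simp [hF, hx]
  have hF_nmem : ∀ (σ : E → E) {x : X}, x ∉ e.target → F σ x = x :=
    fun σ x hx => by simp [hF, hx]
  have hsymm_apply : ∀ y ∈ W, e.symm (h y) = y := fun y hy => by
    rw [← he]; exact e.left_inv (hsrc.symm ▸ hy)
  have hmem_target : ∀ y ∈ W, h y ∈ e.target := fun y hy => by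
    rw [← he]; exact e.map_source (hsrc.symm ▸ hy)
  have hsymm_mem : ∀ {x : X}, x ∈ e.target → e.symm x ∈ W := fun hx => hsrc ▸ e.map_target hx
  -- `F σ (h y) = h (σ y)` on `W`
  have hF_apply : ∀ (σ : E → E), ∀ y ∈ W, F σ (h y) = h (σ y) := fun σ y hy => by
    rw [hF_mem σ (hmem_target y hy), hsymm_apply y hy]
  -- `F σ = id` off `h '' K` when `σ = id` off `K`
  have hF_id : ∀ (σ : E → E), (∀ y, y ∉ K → σ y = y) → ∀ x, x ∉ h '' K → F σ x = x := by
    intro σ hσ x hx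
    by_cases hxt : x ∈ e.target
    · have hyK : e.symm x ∉ K := fun h' => hx ⟨e.symm x, h', by rw [← he]; exact e.right_inv hxt⟩
      rw [hF_mem σ hxt, hσ _ hyK, ← he]
      exact e.right_inv hxt
    · exact hF_nmem σ hxt
  -- mutually inverse
  have hF_inv : ∀ (σ τ : E → E), (∀ y ∈ W, σ y ∈ W) → (∀ y, τ (σ y) = y) →
      ∀ x, F τ (F σ x) = x := by
    intro σ τ hσW hτσ x
    by_cases hxt : x ∈ e.target
    · rw [hF_mem σ hxt, hF_apply τ _ (hσW _ (hsymm_mem hxt)), hτσ, ← he]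
      exact e.right_inv hxt
    · rw [hF_nmem σ hxt, hF_nmem τ hxt]
  -- smoothness
  have hKc : IsClosed (h '' K) := (hK.image_of_continuousOn (hs.continuousOn.mono hKW)).isClosed
  have hF_smooth : ∀ (σ : E → E), ContMDiff 𝓘(ℝ, E) 𝓘(ℝ, E) ∞ σ → (∀ y ∈ W, σ y ∈ W) →
      (∀ y, y ∉ K → σ y = y) → ContMDiff 𝓘(ℝ, E) 𝓘(ℝ, E) ∞ (F σ) := by
    intro σ hσ hσW hσK x
    by_cases hxt : x ∈ e.target
    · -- near `x ∈ e.target`, `F σ = h ∘ σ ∘ e.symm`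
      have hev : F σ =ᶠ[𝓝 x] fun z => h (σ (e.symm z)) :=
        Filter.eventuallyEq_of_mem (e.open_target.mem_nhds hxt) fun z hz => hF_mem σ hz
      refine ContMDiffAt.congr_of_eventuallyEq ?_ hev
      have h1 : ContMDiffAt 𝓘(ℝ, E) 𝓘(ℝ, E) ∞ e.symm x :=
        (hsymm x hxt).contMDiffAt (e.open_target.mem_nhds hxt)
      have h2 : ContMDiffAt 𝓘(ℝ, E) 𝓘(ℝ, E) ∞ (σ ∘ e.symm) x := hσ.contMDiffAt.comp x h1
      have h3 : ContMDiffAt 𝓘(ℝ, E) 𝓘(ℝ, E) ∞ h (σ (e.symm x)) :=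
        hs.contMDiffAt (hW.mem_nhds (hσW _ (hsymm_mem hxt)))
      exact h3.comp x h2
    · -- near `x ∉ h '' K`, `F σ = id`
      have hxK : x ∉ h '' K := by
        rintro ⟨y, hy, rfl⟩
        exact hxt (hmem_target y (hKW hy))
      have hev : F σ =ᶠ[𝓝 x] id :=
        Filter.eventuallyEq_of_mem (hKc.isOpen_compl.mem_nhds hxK) fun z hz => hF_id σ hσK z hz
      exact contMDiffAt_id.congr_of_eventuallyEq hev
  let H : X ≃ₘ⟮𝓘(ℝ, E), 𝓘(ℝ, E)⟯ X :=
    { toFun := F s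
      invFun := F s.symm
      left_inv := hF_inv s s.symm hsW s.symm_apply_apply
      right_inv := hF_inv s.symm s hsW' s.apply_symm_apply
      contMDiff_toFun := hF_smooth s s.contMDiff hsW hsK
      contMDiff_invFun := hF_smooth s.symm s.symm.contMDiff hsW' hsK' }
  exact ⟨H, fun y hy => hF_apply s y hy, fun x hx => hF_id s hsK x hx⟩

end Transport

end Literature.Topology.FourManifolds

end
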